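import Summits.KontsevichZagierPeriods.KontsevichZagierPeriods.Theorems.RootDecompWalshStrataHtypeAtoms

/-!
# Root decomposition (Walsh strata), part 50 — H-type fibre discriminants IV: frames and the indefinite stratum

For a planar quadratic `D` with `disc(D) = 4 d₁₁ d₂₂ − d₁₂² < 0` (the INDEFINITE stratum `R-H` of the node) there
is a rational affine frame `M` with `D = R_H ∘ M`, `R_H = e X² + g − m Y²`, `e, m > 0`:

* `d₁₁ > 0`: the Lagrange frame `lagM` (`D = d₁₁(X² + eκ Y²) + cst`, `eκ < 0`);
* `d₁₁ < 0`: the Lagrange frame followed by the swap `(X, Y) ↦ (Y, X)`;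
* `d₁₁ = 0 ≠ d₂₂`: the transposed quadratic;
* `d₁₁ = d₂₂ = 0` (`d₁₂ ≠ 0`): the hyperbola frame `(X, Y) = ((x' + y')/2, (x' − y')/2)`.

Hence `hW` on the indefinite stratum follows from the residual families `R-HL`, `R-HC` (part 48), and
`QuadricBakerDescent ⟸ R-HL ∧ R-HC ∧ R-Eθ` (`quadricBakerDescent_of_residuals₃`).

References: [KontsevichZagier2001 §1.2 rules (1)–(3)], [BCR1998 §2.2].
-/

noncomputable section

open Set MeasureTheory MvPolynomial Literature.NumberTheory.Transcendental
open Literature.ModelTheory.ExponentialFields (IsSemialgebraic isSemialgebraic_univ isSemialgebraic_empty)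
open Summit.KontsevichZagierPeriods.RootDecompWalshStrata.ConicDescent.VertexChart

namespace Summit.KontsevichZagierPeriods.RootDecompWalshStrata.ConicDescent.BallCube

/-! #### 50.1 Frames of an indefinite planar quadratic -/

/-- Precomposition of an affine map with the coordinate swap. -/
def AffMap.preSwap (M : AffMap) : AffMap := ⟨M.m01, M.m00, M.m11, M.m10, M.c0, M.c1⟩

/-- Auxiliary step `preSwap_toFun`. [bookkeeping] -/
theorem AffMap.preSwap_toFun (M : AffMap) (p : Fin 2 → ℝ) : M.preSwap.toFun p = M.toFun ![p 1, p 0] := by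
  ext i
  have hi : i = 0 ∨ i = 1 := by fin_cases i <;> simp
  rcases hi with rfl | rfl
  · simp only [AffMap.toFun_zero, AffMap.preSwap, Matrix.cons_val_zero, Matrix.cons_val_one]; ring
  · simp only [AffMap.toFun_one, AffMap.preSwap, Matrix.cons_val_zero, Matrix.cons_val_one]; ring

/-- Auxiliary step `preSwap_det`. [bookkeeping] -/
theorem AffMap.preSwap_det (M : AffMap) : M.preSwap.det = -M.det := by
  simp only [AffMap.preSwap, AffMap.det]; ring

namespace Quad2

variable (D : Quad2)

/-- The Lagrange frame followed by the swap: `(x, y) ↦ (Y, X)`. -/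
def lagMs : AffMap := ⟨0, 1, 1, D.d12 / (2 * D.d11), D.β, D.α⟩

/-- Auxiliary step `lagMs_det`. [bookkeeping] -/
theorem lagMs_det : D.lagMs.det = -1 := by
  simp only [lagMs, AffMap.det]; ring

/-- The transposed quadratic `D^T(x, y) = D(y, x)`. -/
def tr : Quad2 := ⟨D.d22, D.d12, D.d11, D.d2, D.d1, D.d0⟩

/-- Auxiliary step `tr_eval`. [bookkeeping] -/
theorem tr_eval (x y : ℝ) : D.tr.eval y x = D.eval x y := by
  simp only [eval, tr]; ring

/-- Auxiliary step `tr_disc`. [bookkeeping] -/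
theorem tr_disc : D.tr.disc = D.disc := by
  simp only [disc, tr]; ring

/-- Auxiliary step `tr_d11`. [bookkeeping] -/
theorem tr_d11 : D.tr.d11 = D.d22 := rfl

/-- The hyperbola frames `((x + d₂/d₁₂) ± (y + d₁/d₁₂))/2`. -/
def hypMp : AffMap := ⟨1 / 2, 1 / 2, 1 / 2, -1 / 2, (D.d1 + D.d2) / (2 * D.d12), (D.d2 - D.d1) / (2 * D.d12)⟩

/-- The hyperbola frame with the two coordinates exchanged. -/
def hypMn : AffMap := ⟨1 / 2, -1 / 2, 1 / 2, 1 / 2, (D.d2 - D.d1) / (2 * D.d12), (D.d1 + D.d2) / (2 * D.d12)⟩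

/-- The constant of the hyperbola normal form. -/
def hcst : ℚ := D.d0 - D.d1 * D.d2 / D.d12

/-- Auxiliary step `hypMp_det`. [bookkeeping] -/
theorem hypMp_det : D.hypMp.det = -1 / 2 := by
  simp only [hypMp, AffMap.det]; ring

/-- Auxiliary step `hypMn_det`. [bookkeeping] -/
theorem hypMn_det : D.hypMn.det = 1 / 2 := by
  simp only [hypMn, AffMap.det]; ring

/-- `d₁₁ > 0`, `disc < 0`: `D = R_H(d₁₁, cst, −d₁₁ eκ) ∘ lagM`. [this node] -/
theorem eval_eq_hrad_pos (h11 : 0 < D.d11) (hdisc : D.disc < 0) (p : Fin 2 → ℝ) :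
    D.eval (p 0) (p 1) = hrad D.d11 D.cst (-(D.d11 * D.eκ)) (D.lagM.toFun p) := by
  rw [D.eval_eq_erad h11.ne' hdisc.ne p, erad, hrad]
  push_cast
  ring

/-- `d₁₁ < 0`, `disc < 0`: `D = R_H(d₁₁ eκ, cst, −d₁₁) ∘ lagMs`. [this node] -/
theorem eval_eq_hrad_neg (h11 : D.d11 < 0) (hdisc : D.disc < 0) (p : Fin 2 → ℝ) :
    D.eval (p 0) (p 1) = hrad (D.d11 * D.eκ) D.cst (-D.d11) (D.lagMs.toFun p) := by
  rw [D.eval_eq_erad h11.ne hdisc.ne p, erad, hrad]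
  simp only [AffMap.toFun_zero, AffMap.toFun_one, lagM, lagMs]
  push_cast
  ring

/-- The weights in the two Lagrange cases are positive. [bookkeeping] -/
theorem hweights_pos (hdisc : D.disc < 0) :
    (0 < D.d11 → 0 < -(D.d11 * D.eκ)) ∧ (D.d11 < 0 → 0 < D.d11 * D.eκ) := by
  refine ⟨fun h11 => ?_, fun h11 => ?_⟩
  · rw [D.d11_mul_eκ h11.ne', Quad2.μ, neg_pos]
    exact div_neg_of_neg_of_pos hdisc (by positivity)
  · rw [D.d11_mul_eκ h11.ne, Quad2.μ]
    exact div_pos_iff.2 (Or.inr ⟨hdisc, by linarith⟩)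

/-- A frame of the transposed quadratic, precomposed with the swap, is a frame of `D`. [bookkeeping] -/
theorem hframe_of_tr {M : AffMap} {e g m : ℚ} (h : ∀ p : Fin 2 → ℝ, D.tr.eval (p 0) (p 1) = hrad e g m (M.toFun p))
    (p : Fin 2 → ℝ) : D.eval (p 0) (p 1) = hrad e g m (M.preSwap.toFun p) := by
  have h' := h ![p 1, p 0]
  simp only [Matrix.cons_val_zero, Matrix.cons_val_one] at h'
  rw [← D.tr_eval, AffMap.preSwap_toFun]
  exact h'

/-- `d₁₁ = d₂₂ = 0 < d₁₂`: `D = R_H(d₁₂, hcst, d₁₂) ∘ hypMp`. [this node] -/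
theorem eval_eq_hrad_hyp_pos (h11 : D.d11 = 0) (h22 : D.d22 = 0) (h12 : D.d12 ≠ 0) (p : Fin 2 → ℝ) :
    D.eval (p 0) (p 1) = hrad D.d12 D.hcst D.d12 (D.hypMp.toFun p) := by
  have h12' : (D.d12 : ℝ) ≠ 0 := by exact_mod_cast h12
  simp only [eval, hrad, hcst, hypMp, AffMap.toFun_zero, AffMap.toFun_one, h11, h22]
  push_cast
  field_simp
  ring

/-- `d₁₁ = d₂₂ = 0 > d₁₂`: `D = R_H(−d₁₂, hcst, −d₁₂) ∘ hypMn`. [this node] -/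
theorem eval_eq_hrad_hyp_neg (h11 : D.d11 = 0) (h22 : D.d22 = 0) (h12 : D.d12 ≠ 0) (p : Fin 2 → ℝ) :
    D.eval (p 0) (p 1) = hrad (-D.d12) D.hcst (-D.d12) (D.hypMn.toFun p) := by
  have h12' : (D.d12 : ℝ) ≠ 0 := by exact_mod_cast h12
  simp only [eval, hrad, hcst, hypMn, AffMap.toFun_zero, AffMap.toFun_one, h11, h22]
  push_cast
  field_simp
  ring

/-- `disc < 0` and `d₁₁ = d₂₂ = 0` force `d₁₂ ≠ 0`. [bookkeeping] -/
theorem d12_ne_of_disc_neg (hdisc : D.disc < 0) (h11 : D.d11 = 0) : D.d12 ≠ 0 := by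
  intro h12
  rw [Quad2.disc, h11, h12] at hdisc
  norm_num at hdisc

end Quad2

/-! #### 50.2 `hW` in an H-frame and on the indefinite stratum -/

namespace Quadric₃

variable (K : Quadric₃)

/-- **`hW` IN AN H-FRAME.**  If `D = R_H ∘ M` (`R_H = e X² + g − m Y²`, `e, m > 0`) for a rational affine frame `M`,
then `[atom, γ√D] ∈ InBaker` for every atom of the wall family and every sign vector, modulo `R-HL`, `R-HC`.
[KontsevichZagier2001 §1.2; this node] -/
theorem sqrtDescentW_Hframe
    (hl : (∀ (e g m γ : ℚ), 0 < e → 1 ≤ m → ∀ (L : Wall), L.k2 ≠ 0 →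
      ∀ (T : Set (Fin 1 → ℝ)) (ζ : (Fin 1 → ℝ) → ℝ), IsSemialgebraic ℚ T → T ⊆ Icc 0 1 →
        IsSemialgebraicFunOn ℚ T ζ → ContinuousOn ζ T →
        (∀ b ∈ T, (0 < b 0 ∧ (m : ℝ) * b 0 ^ 2 < 1) ∧ (0 ≤ ζ b ∧ ζ b ≤ 1) ∧
          0 < (e : ℝ) * ζ b ^ 2 + g ∧
          L.eval (ζ b) (√((e : ℝ) * ζ b ^ 2 + g) * gU m (b 0)) = 0) →
        ∀ r : KZ.IntegralRep 1, r.domain = T →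
          EqOn r.integrand (fun b => (γ : ℝ) * ((e : ℝ) / 3 * ζ b ^ 3 + g * ζ b) * gW m (b 0)) T →
          InBaker (KZ.of r)))
    (hc : (∀ (e g m γ : ℚ), 0 < e → 1 ≤ m → ∀ (Q : Wall),
      ∀ (T : Set (Fin 1 → ℝ)) (ζ : (Fin 1 → ℝ) → ℝ), IsSemialgebraic ℚ T → T ⊆ Icc 0 1 →
        IsSemialgebraicFunOn ℚ T ζ → ContinuousOn ζ T →
        (∀ b ∈ T, (0 < b 0 ∧ (m : ℝ) * b 0 ^ 2 < 1) ∧ (0 ≤ ζ b ∧ ζ b ≤ 1) ∧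
          0 < (e : ℝ) * ζ b ^ 2 + g ∧
          ((e : ℝ) * ζ b ^ 2 + g) * gT m (b 0) ^ 2 =
            (Q.eval (ζ b) (√((e : ℝ) * ζ b ^ 2 + g) * gU m (b 0))) ^ 2) →
        ∀ r : KZ.IntegralRep 1, r.domain = T →
          EqOn r.integrand (fun b => (γ : ℝ) * ((e : ℝ) / 3 * ζ b ^ 3 + g * ζ b) * gW m (b 0)) T →
          InBaker (KZ.of r)))
    (M : AffMap) (hdet : M.det ≠ 0) (e g₀ m : ℚ) (he : 0 < e) (hm : 0 < m)
    (hframe : ∀ p : Fin 2 → ℝ, K.dq.eval (p 0) (p 1) = hrad e g₀ m (M.toFun p))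
    (ℓ₁ ℓ₂ g : Wall) (γ : ℚ) (σ : Fin 6 → SignType)
    (r : KZ.IntegralRep 2) (hrd : r.domain = atomFam (K.wfam ℓ₁ ℓ₂ g) σ)
    (hri : EqOn r.integrand (fun v => (γ : ℝ) * √(K.Dxy (v 0) (v 1))) r.domain) :
    InBaker (KZ.of r) := by
  refine K.sqrtDescentW_generic ℓ₁ ℓ₂ g γ σ r hrd hri fun ho hb hD hi hfr _ _ => ?_
  have hRe : (fun p : Fin 2 → ℝ => K.dq.eval (p 0) (p 1)) = fun p => hrad e g₀ m (M.toFun p) :=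
    funext hframe
  rw [hRe] at hfr
  refine InBaker.of_Haff M hdet γ e g₀ m he hm _ _ r ho hb (fun p hp => ?_) (fun p hp => ?_) hfr hl hc
  · rw [← hframe]; exact hD p hp
  · rw [hi p hp, hframe]

/-- **`hW` ON THE INDEFINITE STRATUM (the residual `R-H`, reduced to `R-HL ∧ R-HC`).**  For a quadric `K` whose
fibre discriminant has `disc < 0`, `[atom, γ√D] ∈ InBaker` for every atom of the wall family `K.wfam ℓ₁ ℓ₂ g` and
every sign vector, modulo the one-variable residual families `R-HL`, `R-HC` of part 48.
[KontsevichZagier2001 §1.2; this node] -/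
theorem sqrtDescentW_Htype
    (hl : (∀ (e g m γ : ℚ), 0 < e → 1 ≤ m → ∀ (L : Wall), L.k2 ≠ 0 →
      ∀ (T : Set (Fin 1 → ℝ)) (ζ : (Fin 1 → ℝ) → ℝ), IsSemialgebraic ℚ T → T ⊆ Icc 0 1 →
        IsSemialgebraicFunOn ℚ T ζ → ContinuousOn ζ T →
        (∀ b ∈ T, (0 < b 0 ∧ (m : ℝ) * b 0 ^ 2 < 1) ∧ (0 ≤ ζ b ∧ ζ b ≤ 1) ∧
          0 < (e : ℝ) * ζ b ^ 2 + g ∧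
          L.eval (ζ b) (√((e : ℝ) * ζ b ^ 2 + g) * gU m (b 0)) = 0) →
        ∀ r : KZ.IntegralRep 1, r.domain = T →
          EqOn r.integrand (fun b => (γ : ℝ) * ((e : ℝ) / 3 * ζ b ^ 3 + g * ζ b) * gW m (b 0)) T →
          InBaker (KZ.of r)))
    (hc : (∀ (e g m γ : ℚ), 0 < e → 1 ≤ m → ∀ (Q : Wall),
      ∀ (T : Set (Fin 1 → ℝ)) (ζ : (Fin 1 → ℝ) → ℝ), IsSemialgebraic ℚ T → T ⊆ Icc 0 1 →
        IsSemialgebraicFunOn ℚ T ζ → ContinuousOn ζ T →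
        (∀ b ∈ T, (0 < b 0 ∧ (m : ℝ) * b 0 ^ 2 < 1) ∧ (0 ≤ ζ b ∧ ζ b ≤ 1) ∧
          0 < (e : ℝ) * ζ b ^ 2 + g ∧
          ((e : ℝ) * ζ b ^ 2 + g) * gT m (b 0) ^ 2 =
            (Q.eval (ζ b) (√((e : ℝ) * ζ b ^ 2 + g) * gU m (b 0))) ^ 2) →
        ∀ r : KZ.IntegralRep 1, r.domain = T →
          EqOn r.integrand (fun b => (γ : ℝ) * ((e : ℝ) / 3 * ζ b ^ 3 + g * ζ b) * gW m (b 0)) T →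
          InBaker (KZ.of r)))
    (hH : K.dq.disc < 0) (ℓ₁ ℓ₂ g : Wall) (γ : ℚ) (σ : Fin 6 → SignType)
    (r : KZ.IntegralRep 2) (hrd : r.domain = atomFam (K.wfam ℓ₁ ℓ₂ g) σ)
    (hri : EqOn r.integrand (fun v => (γ : ℝ) * √(K.Dxy (v 0) (v 1))) r.domain) :
    InBaker (KZ.of r) := by
  rcases lt_trichotomy 0 K.dq.d11 with h11 | h11 | h11
  · exact K.sqrtDescentW_Hframe hl hc K.dq.lagM (by rw [K.dq.lagM_det]; exact one_ne_zero) _ _ _ h11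
      ((K.dq.hweights_pos hH).1 h11) (K.dq.eval_eq_hrad_pos h11 hH) ℓ₁ ℓ₂ g γ σ r hrd hri
  · have hHt : K.dq.tr.disc < 0 := by rw [K.dq.tr_disc]; exact hH
    rcases lt_trichotomy 0 K.dq.d22 with h22 | h22 | h22
    · have h22' : 0 < K.dq.tr.d11 := by rw [K.dq.tr_d11]; exact h22
      exact K.sqrtDescentW_Hframe hl hc K.dq.tr.lagM.preSwap
        (by rw [AffMap.preSwap_det, K.dq.tr.lagM_det]; norm_num) _ _ _ h22'
        ((K.dq.tr.hweights_pos hHt).1 h22')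
        (K.dq.hframe_of_tr (fun p => K.dq.tr.eval_eq_hrad_pos h22' hHt p)) ℓ₁ ℓ₂ g γ σ r hrd hri
    · have h12 := K.dq.d12_ne_of_disc_neg hH h11.symm
      rcases lt_or_gt_of_ne h12 with hn | hp
      · exact K.sqrtDescentW_Hframe hl hc K.dq.hypMn (by rw [K.dq.hypMn_det]; norm_num) _ _ _
          (neg_pos.2 hn) (neg_pos.2 hn) (K.dq.eval_eq_hrad_hyp_neg h11.symm h22.symm h12) ℓ₁ ℓ₂ g γ σ r hrd hri
      · exact K.sqrtDescentW_Hframe hl hc K.dq.hypMp (by rw [K.dq.hypMp_det]; norm_num) _ _ _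
          hp hp (K.dq.eval_eq_hrad_hyp_pos h11.symm h22.symm h12) ℓ₁ ℓ₂ g γ σ r hrd hri
    · have h22' : K.dq.tr.d11 < 0 := by rw [K.dq.tr_d11]; exact h22
      exact K.sqrtDescentW_Hframe hl hc K.dq.tr.lagMs.preSwap
        (by rw [AffMap.preSwap_det, K.dq.tr.lagMs_det]; norm_num) _ _ _
        ((K.dq.tr.hweights_pos hHt).2 h22') (neg_pos.2 h22')
        (K.dq.hframe_of_tr (fun p => K.dq.tr.eval_eq_hrad_neg h22' hHt p)) ℓ₁ ℓ₂ g γ σ r hrd hri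
  · exact K.sqrtDescentW_Hframe hl hc K.dq.lagMs (by rw [K.dq.lagMs_det]; norm_num) _ _ _
      ((K.dq.hweights_pos hH).2 h11) (neg_pos.2 h11) (K.dq.eval_eq_hrad_neg h11 hH) ℓ₁ ℓ₂ g γ σ r hrd hri

end Quadric₃

/-! #### 50.3 The residual form without `R-H` -/

/-- **THE RESIDUAL OF `hW`, III.**  `hW` follows from the one-variable residual families `R-HL`, `R-HC` (sections of
the H-type chart domain along a line with `k₂ ≠ 0`, resp. along a conic wall) and the thin E-type strata `R-Eθ`.
[this node] -/
theorem sqrtDescentW_of_residuals₃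
    (hl : (∀ (e g m γ : ℚ), 0 < e → 1 ≤ m → ∀ (L : Wall), L.k2 ≠ 0 →
      ∀ (T : Set (Fin 1 → ℝ)) (ζ : (Fin 1 → ℝ) → ℝ), IsSemialgebraic ℚ T → T ⊆ Icc 0 1 →
        IsSemialgebraicFunOn ℚ T ζ → ContinuousOn ζ T →
        (∀ b ∈ T, (0 < b 0 ∧ (m : ℝ) * b 0 ^ 2 < 1) ∧ (0 ≤ ζ b ∧ ζ b ≤ 1) ∧
          0 < (e : ℝ) * ζ b ^ 2 + g ∧
          L.eval (ζ b) (√((e : ℝ) * ζ b ^ 2 + g) * gU m (b 0)) = 0) →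
        ∀ r : KZ.IntegralRep 1, r.domain = T →
          EqOn r.integrand (fun b => (γ : ℝ) * ((e : ℝ) / 3 * ζ b ^ 3 + g * ζ b) * gW m (b 0)) T →
          InBaker (KZ.of r)))
    (hc : (∀ (e g m γ : ℚ), 0 < e → 1 ≤ m → ∀ (Q : Wall),
      ∀ (T : Set (Fin 1 → ℝ)) (ζ : (Fin 1 → ℝ) → ℝ), IsSemialgebraic ℚ T → T ⊆ Icc 0 1 →
        IsSemialgebraicFunOn ℚ T ζ → ContinuousOn ζ T →
        (∀ b ∈ T, (0 < b 0 ∧ (m : ℝ) * b 0 ^ 2 < 1) ∧ (0 ≤ ζ b ∧ ζ b ≤ 1) ∧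
          0 < (e : ℝ) * ζ b ^ 2 + g ∧
          ((e : ℝ) * ζ b ^ 2 + g) * gT m (b 0) ^ 2 =
            (Q.eval (ζ b) (√((e : ℝ) * ζ b ^ 2 + g) * gU m (b 0))) ^ 2) →
        ∀ r : KZ.IntegralRep 1, r.domain = T →
          EqOn r.integrand (fun b => (γ : ℝ) * ((e : ℝ) / 3 * ζ b ^ 3 + g * ζ b) * gW m (b 0)) T →
          InBaker (KZ.of r)))
    (hθ : ∀ (L : Quadric₃) (ℓ₁ ℓ₂ g : Wall) (γ : ℚ) (σ : Fin 6 → SignType) (r : KZ.IntegralRep 2),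
      0 < L.dq.disc →
      ¬((L.bwall ℓ₁).precomp L.dq.lagM.inv ∈ goodWalls 1 L.dq.eκ L.dq.d11 L.dq.cst ∧
          (L.bwall ℓ₂).precomp L.dq.lagM.inv ∈ goodWalls 1 L.dq.eκ L.dq.d11 L.dq.cst) →
      r.domain = atomFam (L.wfam ℓ₁ ℓ₂ g) σ →
      EqOn r.integrand (fun v => (γ : ℝ) * √(L.Dxy (v 0) (v 1))) r.domain → InBaker (KZ.of r)) :
    ∀ (L : Quadric₃) (ℓ₁ ℓ₂ g : Wall) (γ : ℚ) (σ : Fin 6 → SignType) (r : KZ.IntegralRep 2),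
      r.domain = atomFam (L.wfam ℓ₁ ℓ₂ g) σ →
      EqOn r.integrand (fun v => (γ : ℝ) * √(L.Dxy (v 0) (v 1))) r.domain → InBaker (KZ.of r) :=
  sqrtDescentW_of_residuals₂ (fun L ℓ₁ ℓ₂ g γ σ r hH hrd hri => L.sqrtDescentW_Htype hl hc hH ℓ₁ ℓ₂ g γ σ r hrd hri)
    hθ

/-- **`QuadricBakerDescent` FROM THREE RESIDUALS** (stmt-KontsevichZagierPeriods-27597 ⟸ R-HL ∧ R-HC ∧ R-Eθ):
the two-variable content of `hW` is exhausted; what remains are one-variable Euler-type terminals along wall edges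
in the H-type chart (to be reparametrised by `VertexChart.edge_pullback`) and the thin E-type corner strata.
[this node] -/
theorem quadricBakerDescent_of_residuals₃
    (hl : (∀ (e g m γ : ℚ), 0 < e → 1 ≤ m → ∀ (L : Wall), L.k2 ≠ 0 →
      ∀ (T : Set (Fin 1 → ℝ)) (ζ : (Fin 1 → ℝ) → ℝ), IsSemialgebraic ℚ T → T ⊆ Icc 0 1 →
        IsSemialgebraicFunOn ℚ T ζ → ContinuousOn ζ T →
        (∀ b ∈ T, (0 < b 0 ∧ (m : ℝ) * b 0 ^ 2 < 1) ∧ (0 ≤ ζ b ∧ ζ b ≤ 1) ∧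
          0 < (e : ℝ) * ζ b ^ 2 + g ∧
          L.eval (ζ b) (√((e : ℝ) * ζ b ^ 2 + g) * gU m (b 0)) = 0) →
        ∀ r : KZ.IntegralRep 1, r.domain = T →
          EqOn r.integrand (fun b => (γ : ℝ) * ((e : ℝ) / 3 * ζ b ^ 3 + g * ζ b) * gW m (b 0)) T →
          InBaker (KZ.of r)))
    (hc : (∀ (e g m γ : ℚ), 0 < e → 1 ≤ m → ∀ (Q : Wall),
      ∀ (T : Set (Fin 1 → ℝ)) (ζ : (Fin 1 → ℝ) → ℝ), IsSemialgebraic ℚ T → T ⊆ Icc 0 1 →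
        IsSemialgebraicFunOn ℚ T ζ → ContinuousOn ζ T →
        (∀ b ∈ T, (0 < b 0 ∧ (m : ℝ) * b 0 ^ 2 < 1) ∧ (0 ≤ ζ b ∧ ζ b ≤ 1) ∧
          0 < (e : ℝ) * ζ b ^ 2 + g ∧
          ((e : ℝ) * ζ b ^ 2 + g) * gT m (b 0) ^ 2 =
            (Q.eval (ζ b) (√((e : ℝ) * ζ b ^ 2 + g) * gU m (b 0))) ^ 2) →
        ∀ r : KZ.IntegralRep 1, r.domain = T →
          EqOn r.integrand (fun b => (γ : ℝ) * ((e : ℝ) / 3 * ζ b ^ 3 + g * ζ b) * gW m (b 0)) T →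
          InBaker (KZ.of r)))
    (hθ : ∀ (L : Quadric₃) (ℓ₁ ℓ₂ g : Wall) (γ : ℚ) (σ : Fin 6 → SignType) (r : KZ.IntegralRep 2),
      0 < L.dq.disc →
      ¬((L.bwall ℓ₁).precomp L.dq.lagM.inv ∈ goodWalls 1 L.dq.eκ L.dq.d11 L.dq.cst ∧
          (L.bwall ℓ₂).precomp L.dq.lagM.inv ∈ goodWalls 1 L.dq.eκ L.dq.d11 L.dq.cst) →
      r.domain = atomFam (L.wfam ℓ₁ ℓ₂ g) σ →
      EqOn r.integrand (fun v => (γ : ℝ) * √(L.Dxy (v 0) (v 1))) r.domain → InBaker (KZ.of r)) :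
    Summit.KontsevichZagierPeriods.KontsevichZagierPeriods.Theses.RootDecompWalshStrata.QuadricBakerDescent :=
  quadricBakerDescent_of_sqrtDescentW (sqrtDescentW_of_residuals₃ hl hc hθ)

end Summit.KontsevichZagierPeriods.RootDecompWalshStrata.ConicDescent.BallCube
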